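import Summits.QuantumFields.GaugeBoot.FluctuationAsymptotics
import Summits.QuantumFields.GaugeBoot.FluctuationOddVanishing
import Summits.QuantumFields.GaugeBoot.SOMasterLoopAssembly
import HarnessLib

/-!
# Fluctuations of Wilson loops, XIV: the limit theorem (gauge-boot, ADDENDUM 32, headline)

HONEST FRAMING (cell `pub-gaugeboot`, page 1 of every file): the venture produces certified bounds
on lattice expectations at stated coupling, gauge group, dimension and torus size; NOT a mass gap,
NOT a continuum limit, NOT a string tension; NOT Yang–Mills-summit-bearing (barriers
`FixedCouplingUltralocality`, `PerturbativeInvisibility`).  Strong-coupling `SO(N)` lattice gauge theory with free boundary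
condition (S. Chatterjee, Comm. Math. Phys. **366** (2019); S. Chatterjee, J. Jafarov, arXiv:1604.04777); nothing about
four-dimensional continuum Yang–Mills or a mass gap.

## Content — ORDER-ONE FLUCTUATIONS OF WILSON LOOPS IN THE 'T HOOFT LIMIT

`wilsonLoop_centeredMoments_limit` (★★★): for `d ≥ 2` and every `n` there is `β_G(d, n) > 0` such that for
`|β| ≤ β_G`, every `log`-admissible sequence of cubes `Λ_N` and all loops `l₁, …, l_m` (`m ≤ n`),
`⟨∏_{i ≤ m} (W_{l_i} − ⟨W_{l_i}⟩)⟩_{Λ_N, N, β} ⟶ Ψ_β(l₁, …, l_m)` as `N → ∞`: the Wilson loop variables — of size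
`N` — have JOINT FLUCTUATIONS OF ORDER ONE with convergent mixed moments; `Ψ_β = 0` for odd `m`, and
`Ψ_β(l, l') = f₄(l, l') − f₄(l) f₀(l') − f₂(l) f₂(l') − f₀(l) f₄(l')` is the covariance of `covariance_limit`.  The limit
is EXPLICIT in the `1/N` coefficients `f_{2k}` of Chatterjee–Jafarov: `Ψ_β(l₁, …, l_m)` is the `m`-th coefficient of the
power-series centered block product `G([]; [l₁], …, [l_m])` (first-block recursion over `P(u) = Σ_k f_{2k}(u) X^k`), all of
whose lower coefficients vanish (`centered_coeff_vanish`) — which is the mechanism: `N^{-m}`-smallness of centered products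
of `m` normalised loops.  More generally the normalised centered block moments
`N^m ⟨(W_{B₀}/N^{|B₀|}) ∏_{j ≤ m} (W_{C_j}/N^{|C_j|} − φ(C_j))⟩ → coeff_m G(B₀; C₁, …, C_m)` for loop SEQUENCES `C_j`.

Not claimed: that `Ψ_β` is Gaussian (Wick's formula for even `m ≥ 4`), nor anything at fixed `N`.
-/

noncomputable section

open Finset Filter Topology PowerSeries MeasureTheory
open Literature.Probability.LatticeModels (Site box)
open Literature.MathematicalPhysics.QuantumFieldTheory.Chatterjee2019LargeN

namespace Summit.QuantumFields.GaugeBoot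

namespace StringDuality

variable {d : ℕ}

/-- Pulling a constant factor out of every factor of a list product. [folklore] -/
theorem prod_map_const_mul {α : Type*} (c : ℝ) (g : α → ℝ) :
    ∀ ls : List α, (ls.map fun l => c * g l).prod = c ^ ls.length * (ls.map g).prod := by
  intro ls
  induction ls with
  | nil => simp
  | cons a t ih => rw [List.map_cons, List.prod_cons, ih, List.length_cons, pow_succ, List.map_cons, List.prod_cons]; ring

/-- ★ The finite-`N` centered block products ARE expectations: with `p = φ_{Λ,N,β}`, the first-block recursion computes
`G_N(B₀; C₁, …, C_m) = ⟨(W_{B₀}/N^{|B₀|}) ∏_j (W_{C_j}/N^{|C_j|} − φ(C_j))⟩_{Λ,N,β}` (linearity of the expectation).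
[new (lane)] -/
theorem centeredN_eq_soExpect (N : ℕ) (β : ℝ) (Λ : Finset (Site d)) {GN : LoopSeq d → List (LoopSeq d) → ℝ}
    (hGN0 : ∀ B₀ : LoopSeq d, GN B₀ [] = phi N β Λ B₀)
    (hGNs : ∀ (B₀ C : LoopSeq d) (rest : List (LoopSeq d)), GN B₀ (C :: rest) = GN (B₀ ++ C) rest - phi N β Λ C * GN B₀ rest) :
    ∀ (Cs : List (LoopSeq d)) (B₀ : LoopSeq d), GN B₀ Cs = soExpect N β Λ (fun U =>
      wilsonProd N B₀ U / (N : ℝ) ^ B₀.length * (Cs.map fun C => wilsonProd N C U / (N : ℝ) ^ C.length - phi N β Λ C).prod) := by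
  have hcont : ∀ Cs : List (LoopSeq d), Continuous fun U =>
      (Cs.map fun C => wilsonProd N C U / (N : ℝ) ^ C.length - phi N β Λ C).prod := fun Cs =>
    continuous_list_prod Cs fun C _ => ((SOMasterLoop.continuous_wilsonProd C).div_const _).sub continuous_const
  have hint : ∀ {f}, Continuous f → Integrable f (soMeasure N β Λ) :=
    fun hf => SOMasterLoop.integrable_real_of_continuous ((N : ℝ) * β) Λ hf
  intro Cs
  induction Cs with
  | nil =>
    intro B₀
    rw [hGN0]
    unfold phi soExpect
    simp only [List.map_nil, List.prod_nil, mul_one]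
    rw [integral_div]
  | cons C rest ih =>
    intro B₀
    rw [hGNs, ih, ih]
    unfold soExpect
    have h1 : Integrable (fun U => wilsonProd N (B₀ ++ C) U / (N : ℝ) ^ (B₀ ++ C).length *
        (rest.map fun C => wilsonProd N C U / (N : ℝ) ^ C.length - phi N β Λ C).prod) (soMeasure N β Λ) :=
      hint (((SOMasterLoop.continuous_wilsonProd (B₀ ++ C)).div_const ((N : ℝ) ^ (B₀ ++ C).length)).mul (hcont rest))
    have h2 : Integrable (fun U => wilsonProd N B₀ U / (N : ℝ) ^ B₀.length *
        (rest.map fun C => wilsonProd N C U / (N : ℝ) ^ C.length - phi N β Λ C).prod) (soMeasure N β Λ) :=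
      hint (((SOMasterLoop.continuous_wilsonProd B₀).div_const ((N : ℝ) ^ B₀.length)).mul (hcont rest))
    rw [← integral_const_mul, ← integral_sub h1 (h2.const_mul _)]
    refine integral_congr_ae (Eventually.of_forall fun U => ?_)
    simp only [List.map_cons, List.prod_cons, wilsonProd, List.map_append, List.prod_append, List.length_append, pow_add]
    ring

/-- ★★★ **ORDER-ONE FLUCTUATIONS OF WILSON LOOPS IN THE 'T HOOFT LIMIT AT STRONG COUPLING.**  For `d ≥ 2` and `n` there
is `β_G > 0` and the `1/N` coefficient family `F (k+2) β s = f_{2k}(s)` (clause 1: the expansion of `φ_{Λ_N,N,β}` along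
`Λ_N = box d N` to every order `k ≤ n`; clause 2: `f₀ = Σ` trajectory weights) such that for `|β| ≤ β_G`, with `G` the
power-series centered block product over `P(u) = Σ_k f_{2k}(u) X^k` (clauses 3–4: its recursion), (5) `coeff_k G(B₀; C₁..C_m)
= 0` for `k < m`, `k ≤ n`; (6) along every `log`-admissible `Λ_N = box d (M N)` the normalised centered block moments
converge, `N^m ⟨(W_{B₀}/N^{|B₀|}) ∏_j (W_{C_j}/N^{|C_j|} − φ(C_j))⟩ → coeff_m G(B₀; C₁..C_m)` (`m ≤ n`); (7) in particular
`⟨∏_{i ≤ m} (W_{l_i} − ⟨W_{l_i}⟩)⟩_{Λ_N,N,β} → Ψ_β(l₁..l_m) := coeff_m G([]; [l₁]..[l_m])`; (8) `coeff_m G = 0` for odd `m`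
(so all odd mixed centered moments tend to `0`); (9) `Ψ_β(l, l')` is the limiting covariance
`f₄(l,l') − f₄(l)f₀(l') − f₂(l)f₂(l') − f₀(l)f₄(l')`. [new (lane)] -/
theorem wilsonLoop_centeredMoments_limit (hd : 2 ≤ d) (n : ℕ) :
    ∃ βG : ℝ, 0 < βG ∧ ∃ F : ℕ → ℝ → LoopSeq d → ℝ,
      (∀ k, k ≤ n → ∀ β : ℝ, |β| ≤ βG → ∀ s : LoopSeq d, IsLoopSeq s →
        Tendsto (fun N : ℕ => (N : ℝ) ^ k *
          (phi N β (box d N) s - ∑ i ∈ Finset.range k, F (i + 2) β s / (N : ℝ) ^ i)) atTop (𝓝 (F (k + 2) β s))) ∧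
      (∀ β : ℝ, |β| ≤ βG → ∀ s : LoopSeq d, IsLoopSeq s → F 2 β s = ∑' X : Trajectory s, X.weight β) ∧
      ∀ β : ℝ, |β| ≤ βG → ∃ G : LoopSeq d → List (LoopSeq d) → PowerSeries ℝ,
        (∀ B₀ : LoopSeq d, G B₀ [] = PowerSeries.mk fun k => F (k + 2) β B₀) ∧
        (∀ (B₀ C : LoopSeq d) (rest : List (LoopSeq d)),
          G B₀ (C :: rest) = G (B₀ ++ C) rest - (PowerSeries.mk fun k => F (k + 2) β C) * G B₀ rest) ∧
        (∀ k, k ≤ n → ∀ (B₀ : LoopSeq d) (Cs : List (LoopSeq d)), IsLoopSeq B₀ → (∀ C ∈ Cs, IsLoopSeq C) →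
          k < Cs.length → coeff k (G B₀ Cs) = 0) ∧
        (∀ M : ℕ → ℕ, (∀ a : ℕ, ∀ᶠ N : ℕ in atTop, a * Nat.log 2 N ≤ M N) →
          ∀ (B₀ : LoopSeq d) (Cs : List (LoopSeq d)), IsLoopSeq B₀ → (∀ C ∈ Cs, IsLoopSeq C) → Cs.length ≤ n →
            Tendsto (fun N : ℕ => (N : ℝ) ^ Cs.length * soExpect N β (box d (M N)) (fun U =>
              wilsonProd N B₀ U / (N : ℝ) ^ B₀.length *
                (Cs.map fun C => wilsonProd N C U / (N : ℝ) ^ C.length - phi N β (box d (M N)) C).prod)) atTop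
              (𝓝 (coeff Cs.length (G B₀ Cs)))) ∧
        (∀ M : ℕ → ℕ, (∀ a : ℕ, ∀ᶠ N : ℕ in atTop, a * Nat.log 2 N ≤ M N) →
          ∀ ls : LoopSeq d, IsLoopSeq ls → ls.length ≤ n →
            Tendsto (fun N : ℕ => soExpect N β (box d (M N)) (fun U =>
              (ls.map fun l => wilsonLoopVar N l U - soExpect N β (box d (M N)) (wilsonLoopVar N l)).prod)) atTop
              (𝓝 (coeff ls.length (G [] (ls.map fun l => [l]))))) ∧
        (∀ m, m ≤ n → Odd m → ∀ (B₀ : LoopSeq d) (Cs : List (LoopSeq d)), IsLoopSeq B₀ → (∀ C ∈ Cs, IsLoopSeq C) →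
          Cs.length = m → coeff m (G B₀ Cs) = 0) ∧
        (2 ≤ n → ∀ l l' : List (DEdge d), coeff 2 (G [] [[l], [l']]) =
          F 4 β [l, l'] - F 4 β [l] * F 2 β [l'] - F 3 β [l] * F 3 β [l'] - F 2 β [l] * F 4 β [l']) := by
  obtain ⟨β₀, hpos, hanti, C, L, hC, hL, F, hF0, hF1, HA, HB, -⟩ := oneOverN_master d hd
  have hmono : Antitone β₀ := antitone_nat_of_succ_le hanti
  -- ### constants
  set Cc : ℝ := 1 + ∑ j ∈ Finset.range (n + 1), C j with hCc
  set Lc : ℝ := ∑ j ∈ Finset.range (n + 1), L j with hLc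
  have hCsum : 0 ≤ ∑ j ∈ Finset.range (n + 1), C j := Finset.sum_nonneg fun j _ => hC j
  have hCc1 : 1 ≤ Cc := by rw [hCc]; linarith
  have hCj : ∀ j, j ≤ n → C j ≤ Cc := fun j hj => by
    have h := Finset.single_le_sum (f := C) (fun i _ => hC i) (Finset.mem_range.mpr (Nat.lt_succ_of_le hj))
    rw [hCc]; linarith
  have hLj : ∀ j, j ≤ n → L j ≤ Lc := fun j hj => by
    rw [hLc]
    exact Finset.single_le_sum (f := L) (fun i _ => zero_le_one.trans (hL i)) (Finset.mem_range.mpr (Nat.lt_succ_of_le hj))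
  have hLc1 : 1 ≤ Lc := (hL 0).trans (hLj 0 (Nat.zero_le n))
  set βG : ℝ := min (β₀ n) (1 / (4096 * ((d : ℝ) + 1) * (((1 + (n + 1) * Cc) * Lc) ^ 2 + 4) ^ 4)) with hβG
  have hβGpos : 0 < βG := lt_min (hpos n) (by positivity)
  refine ⟨βG, hβGpos, F, fun k hk β hβ s hs => (HA k β (hβ.trans ((min_le_left _ _).trans (hmono hk)))).2.2.2.2.1 s hs,
    fun β hβ s hs => HB β (hβ.trans ((min_le_left _ _).trans (hmono (Nat.zero_le n)))) s hs, ?_⟩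
  intro β hβ
  have hbk : ∀ k, k ≤ n → |β| ≤ β₀ k := fun k hk => hβ.trans ((min_le_left _ _).trans (hmono hk))
  have hβc : |β| ≤ 1 / (4096 * ((d : ℝ) + 1) * (((1 + (n + 1) * Cc) * Lc) ^ 2 + 4) ^ 4) := hβ.trans (min_le_right _ _)
  -- ### the facts at orders `≤ n`
  have hnil : ∀ k, k ≤ n → F (k + 2) β [] = if k = 0 then 1 else 0 := fun k hk => (HA k β (hbk k hk)).1
  have hbd : ∀ j, j ≤ n → ∀ u : LoopSeq d, IsLoopSeq u → |F (j + 2) β u| ≤ Cc * Lc ^ u.len := by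
    intro j hj u hu
    refine ((HA j β (hbk j hj)).2.1 u hu).trans ?_
    exact mul_le_mul (hCj j hj) (pow_le_pow_left₀ (zero_le_one.trans (hL j)) (hLj j hj) _)
      (pow_nonneg (zero_le_one.trans (hL j)) _) (by linarith [hCj j hj, hC j])
  have hrec : ∀ k, k ≤ n → ∀ s : LoopSeq d, IsLoopSeq s → s ≠ [] →
      (s.len : ℝ) * F (k + 2) β s -
          ((∑ o : InvIdx s, F (k + 2) β (s.negSplitAt o)) - (∑ o : SameIdx s, F (k + 2) β (s.posSplitAt o))
            + β * (∑ o : DeformIdx s, F (k + 2) β (s.negDeformAt o))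
            - β * (∑ o : DeformIdx s, F (k + 2) β (s.posDeformAt o))) =
        (s.len : ℝ) * F (k + 1) β s
          + ((∑ o : SameIdx s, F (k + 1) β (s.negTwistAt o)) - ∑ o : InvIdx s, F (k + 1) β (s.posTwistAt o))
          + ((∑ o : MergeIdx s, F k β (s.negMergeAt o)) - ∑ o : MergeIdx s, F k β (s.posMergeAt o)) :=
    fun k hk => (HA k β (hbk k hk)).2.2.1
  have hexpN : ∀ k, k ≤ n → ∀ s : LoopSeq d, IsLoopSeq s →
      Tendsto (fun N : ℕ => (N : ℝ) ^ k *
        (phi N β (box d N) s - ∑ i ∈ Finset.range k, F (i + 2) β s / (N : ℝ) ^ i)) atTop (𝓝 (F (k + 2) β s)) :=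
    fun k hk => (HA k β (hbk k hk)).2.2.2.2.1
  have hperm := expansion_coeff_perm hexpN
  -- ### the power-series data
  obtain ⟨P, hPdef⟩ : ∃ P : LoopSeq d → PowerSeries ℝ, ∀ u, P u = PowerSeries.mk fun k => F (k + 2) β u := ⟨_, fun _ => rfl⟩
  have hP : ∀ (u : LoopSeq d) (k : ℕ), coeff k (P u) = F (k + 2) β u := fun u k => by rw [hPdef, coeff_mk]
  obtain ⟨G, hG0, hGs⟩ := centered_exists (R := PowerSeries ℝ) P
  have hvan := centered_coeff_vanish hCc1 hLc1 (hF0 β) (hF1 β) hrec hperm hnil hbd hβc P hP hG0 hGs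
  have hodd := centered_coeff_odd_vanish hCc1 hLc1 (hF0 β) (hF1 β) hrec hperm hnil hbd hβc P hP hG0 hGs
  -- ### the general moment clause
  have hmom : ∀ M : ℕ → ℕ, (∀ a : ℕ, ∀ᶠ N : ℕ in atTop, a * Nat.log 2 N ≤ M N) →
      ∀ (B₀ : LoopSeq d) (Cs : List (LoopSeq d)), IsLoopSeq B₀ → (∀ C ∈ Cs, IsLoopSeq C) → Cs.length ≤ n →
        Tendsto (fun N : ℕ => (N : ℝ) ^ Cs.length * soExpect N β (box d (M N)) (fun U =>
          wilsonProd N B₀ U / (N : ℝ) ^ B₀.length *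
            (Cs.map fun C => wilsonProd N C U / (N : ℝ) ^ C.length - phi N β (box d (M N)) C).prod)) atTop
          (𝓝 (coeff Cs.length (G B₀ Cs))) := by
    intro M hM B₀ Cs hB₀ hCs hlen
    choose GN hGN0 hGNs using fun N : ℕ => centered_exists (R := ℝ) (fun u : LoopSeq d => phi N β (box d (M N)) u)
    have hexp : ∀ u : LoopSeq d, IsLoopSeq u →
        Tendsto (fun N : ℕ => (N : ℝ) ^ n * (phi N β (box d (M N)) u - (trunc (n + 1) (P u)).eval ((1 : ℝ) / N)))
          atTop (𝓝 0) := by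
      intro u hu
      rw [hPdef]
      exact hasExp_of_expansion (c := fun i => F (i + 2) β u) ((HA n β (hbk n le_rfl)).2.2.2.1 M hM u hu)
    have h := centered_tendsto_leading (pN := fun N u => phi N β (box d (M N)) u) hexp hGN0 hGNs hG0 hGs hvan
      B₀ Cs hB₀ hCs hlen
    refine h.congr fun N => ?_
    rw [centeredN_eq_soExpect N β (box d (M N)) (hGN0 N) (hGNs N) Cs B₀]
  refine ⟨G, fun B₀ => by rw [hG0, hPdef], fun B₀ C' rest => by rw [hGs, hPdef], hvan, hmom, ?_, hodd, ?_⟩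
  · -- ### the Wilson-loop form for single loops
    intro M hM ls hls hlen
    have hnilS : IsLoopSeq ([] : LoopSeq d) := fun l hl => by simp at hl
    have hCs : ∀ C ∈ ls.map (fun l => [l]), IsLoopSeq C := by
      intro C hC
      obtain ⟨l, hl, rfl⟩ := List.mem_map.mp hC
      exact fun w hw => by rw [List.mem_singleton.mp hw]; exact hls l hl
    have h := hmom M hM [] (ls.map fun l => [l]) hnilS hCs (by rw [List.length_map]; exact hlen)
    rw [List.length_map] at h
    refine h.congr' ?_
    filter_upwards [eventually_gt_atTop 0] with N hN
    have hN : (N : ℝ) ≠ 0 := by exact_mod_cast hN.ne'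
    have hφ : ∀ l : List (DEdge d), soExpect N β (box d (M N)) (wilsonLoopVar N l) = (N : ℝ) * phi N β (box d (M N)) [l] := by
      intro l
      have hw : wilsonProd N [l] = wilsonLoopVar N l := by funext U; simp [wilsonProd]
      unfold phi
      rw [hw, List.length_singleton, pow_one, mul_div_cancel₀ _ hN]
    have hfun : (fun U =>
        (ls.map fun l => wilsonLoopVar N l U - soExpect N β (box d (M N)) (wilsonLoopVar N l)).prod) =
        fun U => (N : ℝ) ^ ls.length * (wilsonProd N [] U / (N : ℝ) ^ ([] : LoopSeq d).length *
          ((ls.map fun l => [l]).map fun C => wilsonProd N C U / (N : ℝ) ^ C.length - phi N β (box d (M N)) C).prod) := by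
      funext U
      have h1 : wilsonProd N [] U / (N : ℝ) ^ ([] : LoopSeq d).length = 1 := by simp [wilsonProd]
      rw [h1, one_mul, List.map_map, ← prod_map_const_mul]
      congr 1
      refine List.map_congr_left fun l _ => ?_
      have hw : wilsonProd N [l] U = wilsonLoopVar N l U := by simp [wilsonProd]
      simp only [Function.comp_apply, List.length_singleton, pow_one, hw, hφ l]
      rw [mul_sub, mul_div_cancel₀ _ hN]
    rw [hfun]
    unfold soExpect
    rw [integral_const_mul]
  · -- ### the covariance
    intro hn2 l l'
    have hlow : ∀ j, j ≤ 2 → coeff j (P [l'] * P []) = coeff j (P [l']) := by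
      intro j hj
      rw [PowerSeries.coeff_mul, Finset.sum_eq_single (j, 0)]
      · rw [hP [] 0, hnil 0 (by omega), if_pos rfl, mul_one]
      · intro q hq hne
        have hq' : q.1 + q.2 = j := Finset.HasAntidiagonal.mem_antidiagonal.mp hq
        have hq2 : q.2 ≠ 0 := fun h => hne (by ext <;> simp <;> omega)
        rw [hP [] q.2, hnil q.2 (by omega), if_neg hq2, mul_zero]
      · intro h; exact absurd (Finset.HasAntidiagonal.mem_antidiagonal.mpr (by simp)) h
    have hz : coeff 2 (P [l] * (P [l'] - P [l'] * P [])) = 0 := by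
      rw [PowerSeries.coeff_mul]
      refine Finset.sum_eq_zero fun q hq => ?_
      have hq' : q.1 + q.2 = 2 := Finset.HasAntidiagonal.mem_antidiagonal.mp hq
      rw [map_sub, hlow q.2 (by omega), sub_self, mul_zero]
    have hprod : coeff 2 (P [l'] * P [l]) = F 2 β [l'] * F 4 β [l] + F 3 β [l'] * F 3 β [l] + F 4 β [l'] * F 2 β [l] := by
      rw [PowerSeries.coeff_mul, Finset.Nat.sum_antidiagonal_eq_sum_range_succ_mk]
      simp only [Finset.sum_range_succ, Finset.sum_range_zero, zero_add, hP]
    have e : ([l] ++ [l'] : LoopSeq d) = [l, l'] := rfl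
    simp only [hGs, hG0, List.nil_append, e]
    rw [map_sub, map_sub, hz, sub_zero, hprod, hP]
    ring

end StringDuality

end Summit.QuantumFields.GaugeBoot

end
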